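import Summits.CriticalPhenomena.PercolationContinuityZ3.Theorems.PercNearOneGluingNoHeavyLowerTailSahiSlotPairConeThresholdCylinder
import Summits.CriticalPhenomena.PercolationContinuityZ3.Theorems.PercNearOneGluingNoHeavyLowerTailSahiSlotPairConeThree

/-!
# Sandwiches over `[3]^3`: the five gen-24 lift theorems applied to the kernel `(3,3)` cell

Support file of the one-cut programme (crux `NoHeavyLowerTail`, stmt-CriticalPhenomena-4575; cell `prim-masterthm`, seat P3, gen 24;
`run/shared/lean/prim/prim-masterthm/prim-masterthm-p3/HIERARCHY.md` §32).

With gen 23's `pinnedGood_three` (every up-set of `[3]^3` is pinned-good) the lift theorems `PinnedGood.topSand` (file `…PairConeTopSandwich`),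
`PinnedGood.thrSand` (`…PairConeThresholdSandwich`), `PinnedGood.thrMid` (`…PairConeThresholdMiddle`) and `PinnedGood.thrCylTop`,
`PinnedGood.thrCylTwo` (`…PairConeThresholdCylinder`) give five explicit new families of pinned-good up-sets of `[3]^4` — part of the kernel-certified portion of the open `(4,3)` cell (whose numerical pivotal-pair census,
763 864 `S_4`-classes, is complete and clean, HIERARCHY §32(f)):
* `pinnedGood_topSand_three`: `D × {1} ∪ ⊤ × {2}` for every up-set `D ⊆ [3]^3`;
* `pinnedGood_thrSand_three`: `X × {1} ∪ Θ × {2}` for every up-set `X ⊆ Θ = {x ∈ [3]^3 : x_last ≥ 1}`;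
* `pinnedGood_thrMid_three`: `Θ × {1} ∪ E × {2}` for every up-set `E ⊇ Θ` of `[3]^3`;
* `pinnedGood_thrCylTop_three`, `pinnedGood_thrCylTwo_three`: `Θ × [3] ∪ E × {2}` and `Θ × [3] ∪ E × {1,2}` for every up-set `E ⊇ Θ` of `[3]^3`;
with the value-level forms (`0 ≤ sStarD …` for all up-sets `B, C ⊆ [3]^4`).
HONEST LABEL: instances of certificate-format theorems; the `(4,3)` cell itself stays OPEN in the kernel.  Pure, standard axioms. [this work]
-/

noncomputable section

namespace Summit.CriticalPhenomena.PercolationContinuityZ3.Theorems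

open Finset Function
open Literature.Combinatorics.Sahi2008

namespace SahiSlot

open SahiGridPattern SahiGrid3

/-- Top sandwich over `[3]^3`: `D × {1} ∪ ⊤ × {2} ⊆ [3]^4` is pinned-good for every up-set `D`. [this work] -/
theorem pinnedGood_topSand_three {D : Finset P3} (hD : IsUpperSet (D : Set P3)) : PinnedGood 4 (topSand D) :=
  (pinnedGood_three hD).topSand hD

/-- Threshold-top sandwich over `[3]^3`: `X × {1} ∪ Θ × {2} ⊆ [3]^4` is pinned-good for every up-set `X ⊆ Θ`. [this work] -/
theorem pinnedGood_thrSand_three {X : Finset P3} (hX : IsUpperSet (X : Set P3)) (hXT : X ⊆ Thr 2) :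
    PinnedGood 4 (thrSand X) :=
  (pinnedGood_three hX).thrSand hX hXT

/-- Threshold-middle lift over `[3]^3`: `Θ × {1} ∪ E × {2} ⊆ [3]^4` is pinned-good for every up-set `E ⊇ Θ`. [this work] -/
theorem pinnedGood_thrMid_three {E : Finset P3} (hE : IsUpperSet (E : Set P3)) (hTE : Thr 2 ⊆ E) :
    PinnedGood 4 (thrMid E) :=
  (pinnedGood_three hE).thrMid hE hTE

/-- Threshold-cylinder-top lift over `[3]^3`: `Θ × [3] ∪ E × {2} ⊆ [3]^4` is pinned-good for every up-set `E ⊇ Θ`. [this work] -/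
theorem pinnedGood_thrCylTop_three {E : Finset P3} (hE : IsUpperSet (E : Set P3)) (hTE : Thr 2 ⊆ E) :
    PinnedGood 4 (thrCylTop E) :=
  (pinnedGood_three hE).thrCylTop hTE

/-- Threshold-cylinder-two lift over `[3]^3`: `Θ × [3] ∪ E × {1,2} ⊆ [3]^4` is pinned-good for every up-set `E ⊇ Θ`. [this work] -/
theorem pinnedGood_thrCylTwo_three {E : Finset P3} (hE : IsUpperSet (E : Set P3)) (hTE : Thr 2 ⊆ E) :
    PinnedGood 4 (thrCylTwo E) :=
  (pinnedGood_three hE).thrCylTwo hTE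

/-- Value level: `0 ≤ sStarD (D × {1} ∪ ⊤ × {2}) B C` for all up-sets `D ⊆ [3]^3`, `B, C ⊆ [3]^4`. [this work] -/
theorem sStarD_topSand_three_nonneg {D : Finset P3} (hD : IsUpperSet (D : Set P3)) (B C : Finset (Pd 4))
    (hB : IsUpperSet (B : Set (Pd 4))) (hC : IsUpperSet (C : Set (Pd 4))) : 0 ≤ sStarD (topSand D) B C :=
  (pinnedGood_topSand_three hD).sStarD_nonneg B C hB hC

/-- Value level: `0 ≤ sStarD (X × {1} ∪ Θ × {2}) B C` for all up-sets `X ⊆ Θ ⊆ [3]^3`, `B, C ⊆ [3]^4`. [this work] -/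
theorem sStarD_thrSand_three_nonneg {X : Finset P3} (hX : IsUpperSet (X : Set P3)) (hXT : X ⊆ Thr 2) (B C : Finset (Pd 4))
    (hB : IsUpperSet (B : Set (Pd 4))) (hC : IsUpperSet (C : Set (Pd 4))) : 0 ≤ sStarD (thrSand X) B C :=
  (pinnedGood_thrSand_three hX hXT).sStarD_nonneg B C hB hC

/-- Value level: `0 ≤ sStarD (Θ × {1} ∪ E × {2}) B C` for all up-sets `E ⊇ Θ` of `[3]^3`, `B, C ⊆ [3]^4`. [this work] -/
theorem sStarD_thrMid_three_nonneg {E : Finset P3} (hE : IsUpperSet (E : Set P3)) (hTE : Thr 2 ⊆ E) (B C : Finset (Pd 4))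
    (hB : IsUpperSet (B : Set (Pd 4))) (hC : IsUpperSet (C : Set (Pd 4))) : 0 ≤ sStarD (thrMid E) B C :=
  (pinnedGood_thrMid_three hE hTE).sStarD_nonneg B C hB hC

end SahiSlot

end Summit.CriticalPhenomena.PercolationContinuityZ3.Theorems
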